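import Mathlib.Analysis.Calculus.ContDiff.Defs
import Mathlib.Analysis.Calculus.FDeriv.Basic
import Mathlib.Analysis.InnerProductSpace.PiL2
import Mathlib.Analysis.Matrix.Order
import Mathlib.MeasureTheory.Integral.Bochner.Basic
import Mathlib.MeasureTheory.Measure.Haar.InnerProductSpace
import Literature.Analysis.FunctionSpaces.SobolevDomain
import HarnessLib

/-!
# The two-dimensional convex-integration lemma for the linearised pressureless Euler system

Topic `Analysis/FluidPDE`. One named fact, `ConvexIntegrationLemma2D` (not proved here: its
published proof is the De Lellis–Székelyhidi Baire-category argument with localised plane waves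
and the geometry of the relaxed constitutive set — an `XL` item; see
`Literature/Barriers/AtomisticToContinuum/WildSolutionsProofs.lean`, where the fact is the only
unproved input of the barrier `WildSolutionsBarrier`).

## The result as printed

Chiodaroli–De Lellis–Kreml, *Global ill-posedness of the isentropic system of gas dynamics*,
CPAM 68 (2015), **Lemma 3.7** (restated verbatim as Lemma 3.2 of Chiodaroli–Kreml, ARMA 214
(2014), and — with a fixed-density barotropic bookkeeping, `n ∈ {2, 3}`, `C¹` subsolutions on
Lipschitz space–time domains — as Theorem 5.3.1 with Theorem 5.1.2 (a)–(c) of Markfelder,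
LNM 2294 (2021)): *Let `(v₀, u₀) ∈ ℝ² × Sym₀(2)` and `C > 0` be such that
`v₀ ⊗ v₀ - u₀ < (C/2) Id`. For any open set `Ω ⊂ ℝ² × ℝ` there are infinitely many maps
`(v̲, u̲) ∈ L^∞(ℝ² × ℝ; ℝ² × Sym₀(2))` with the following property:
(i) `v̲` and `u̲` vanish identically outside `Ω`;
(ii) `div_x v̲ = 0` and `∂ₜ v̲ + div_x u̲ = 0`;
(iii) `(v₀ + v̲) ⊗ (v₀ + v̲) - (u₀ + u̲) = (C/2) Id` a.e. on `Ω`.*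
Here `Sym₀(2)` is the space of symmetric trace-free `2 × 2` matrices, (ii) is meant in the
sense of distributions on `ℝ² × ℝ`, and `A < B` for symmetric matrices means `B - A` is
positive definite.

## Formal rendering

Space–time is `ℝ × ℝ²` with time first (`ℝ² = EuclideanSpace ℝ (Fin 2)`), as in
`Literature/Barriers/AtomisticToContinuum/WildSolutions.lean`. We record the full velocity
`v := v₀ + v̲` on `Ω` rather than the perturbation: by (iii) and trace-freeness of `u₀ + u̲`,
`|v|² = C` a.e. on `Ω` and `u̲ = v ⊗ v - (C/2) Id - u₀` a.e. on `Ω`; conversely these two facts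
recover a trace-free symmetric `u̲` with (iii). With (i), the two distributional equations (ii)
on all of `ℝ² × ℝ` read, for all `φ ∈ C_c^∞(ℝ × ℝ²; ℝ)` and `w ∈ C_c^∞(ℝ × ℝ²; ℝ²)`,
`∫_Ω (v - v₀) · ∇ₓφ = 0` and `∫_Ω [(v - v₀) · ∂ₜw + (v ⊗ v - (C/2) Id - u₀) : ∇ₓw] = 0`
(`A : ∇w = ∑ᵢⱼ Aᵢⱼ ∂ⱼwᵢ`), which is what the `Prop` states. "Infinitely many maps" (elements of
`L^∞`, i.e. a.e.-classes) is rendered as a sequence of measurable representatives that are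
pairwise not a.e. equal on `Ω`; this requires the tacit printed hypothesis `Ω ≠ ∅` ("for any
open set `Ω`" presupposes a non-empty one: for `Ω = ∅` condition (i) leaves only the zero map),
which we state explicitly as `Ω.Nonempty` (review of p13842); `u₀ ∈ Sym₀(2)` as a symmetric trace-free `Matrix (Fin 2) (Fin 2) ℝ`
and the strict subsolution condition as `Matrix.PosDef ((C/2) • 1 - (v₀ ⊗ v₀ - u₀))`. Test
functions are `Literature.IsTestFunctionOn ⊤` (smooth, compactly supported on the whole space) and
`∂ₜ`, `∂ⱼ` are Fréchet derivatives in the directions `(1, 0)`, `(0, eⱼ)`.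

## References

* E. Chiodaroli, C. De Lellis, O. Kreml, *Global ill-posedness of the isentropic system of gas
  dynamics*, Comm. Pure Appl. Math. 68 (2015) 1157–1190, Lemma 3.7 (and §4 for its proof).
* S. Markfelder, *Convex Integration Applied to the Multi-Dimensional Compressible Euler
  Equations*, LNM 2294 (2021), Thm 5.1.2, Thm 5.3.1, Prop. 4.4.1.
* C. De Lellis, L. Székelyhidi Jr., Arch. Ration. Mech. Anal. 195 (2010) 225–260, Prop. 2.
-/

noncomputable section

open MeasureTheory Set

namespace Literature.Analysis.FluidPDE.ConvexIntegration

/-- **Convex-integration lemma for the 2-D linearised pressureless Euler system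
(Chiodaroli–De Lellis–Kreml 2015, Lemma 3.7; = Markfelder 2021, Thm 5.3.1 for constant
two-dimensional subsolutions).** For every non-empty open `Ω ⊆ ℝ × ℝ²`, every `v₀ ∈ ℝ²`, every symmetric
trace-free `u₀ ∈ ℝ^{2×2}` and every `C > 0` with `(C/2) Id - (v₀ ⊗ v₀ - u₀)` positive definite,
there is a sequence `(vₙ)` of measurable velocity fields on `ℝ × ℝ²`, pairwise not a.e. equal
on `Ω`, such that for every `n`: `|vₙ|² = C` a.e. on `Ω`; `∫_Ω (vₙ - v₀) · ∇ₓφ = 0` for every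
real test function `φ`; and `∫_Ω [(vₙ - v₀) · ∂ₜw + (vₙ ⊗ vₙ - (C/2) Id - u₀) : ∇ₓw] = 0` for
every `ℝ²`-valued test function `w` (i.e. `v̲ := 1_Ω (vₙ - v₀)`, `u̲ := 1_Ω (vₙ ⊗ vₙ - (C/2) Id - u₀)`
are bounded, vanish outside `Ω`, solve `div_x v̲ = 0`, `∂ₜv̲ + div_x u̲ = 0` in `𝒟'(ℝ × ℝ²)` and
satisfy `(v₀ + v̲) ⊗ (v₀ + v̲) - (u₀ + u̲) = (C/2) Id` a.e. on `Ω`).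
[cite: ChiodaroliDeLellisKreml2015, Lemma 3.7] [cite: Markfelder2021, Thm 5.3.1 with Thm 5.1.2 (a)–(c)] -/
def ConvexIntegrationLemma2D : Prop :=
  ∀ (Ω : Set (ℝ × EuclideanSpace ℝ (Fin 2))), IsOpen Ω → Ω.Nonempty →
  ∀ (v₀ : EuclideanSpace ℝ (Fin 2)) (u₀ : Matrix (Fin 2) (Fin 2) ℝ) (C : ℝ),
    u₀.IsSymm → u₀.trace = 0 → 0 < C →
    ((C / 2) • (1 : Matrix (Fin 2) (Fin 2) ℝ) - (Matrix.vecMulVec v₀ v₀ - u₀)).PosDef →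
    ∃ v : ℕ → ℝ × EuclideanSpace ℝ (Fin 2) → EuclideanSpace ℝ (Fin 2),
      (∀ n n', n ≠ n' → ¬ (v n =ᵐ[volume.restrict Ω] v n')) ∧
      ∀ n, Measurable (v n) ∧
        (∀ᵐ z ∂(volume.restrict Ω), ‖v n z‖ ^ 2 = C) ∧
        (∀ φ : ℝ × EuclideanSpace ℝ (Fin 2) → ℝ, Literature.Analysis.FunctionSpaces.IsTestFunctionOn ⊤ φ →
          ∫ z in Ω, ∑ j, (v n z j - v₀ j) * fderiv ℝ φ z (0, EuclideanSpace.single j 1) = 0) ∧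
        (∀ w : ℝ × EuclideanSpace ℝ (Fin 2) → EuclideanSpace ℝ (Fin 2),
          Literature.Analysis.FunctionSpaces.IsTestFunctionOn ⊤ w →
          ∫ z in Ω, (∑ i, (v n z i - v₀ i) * fderiv ℝ w z (1, 0) i +
            ∑ i, ∑ j, (v n z i * v n z j - (if i = j then C / 2 else 0) - u₀ i j) *
              fderiv ℝ w z (0, EuclideanSpace.single j 1) i) = 0)

/-- Under `ConvexIntegrationLemma2D` there are, in particular, two admissible velocity fields on
`Ω` that are not a.e. equal (the simplest form of "infinitely many").
[cite: ChiodaroliDeLellisKreml2015, Lemma 3.7] -/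
theorem ConvexIntegrationLemma2D.exists_two (h : ConvexIntegrationLemma2D)
    {Ω : Set (ℝ × EuclideanSpace ℝ (Fin 2))} (hΩ : IsOpen Ω) (hΩne : Ω.Nonempty)
    (v₀ : EuclideanSpace ℝ (Fin 2))
    {u₀ : Matrix (Fin 2) (Fin 2) ℝ} {C : ℝ} (hsymm : u₀.IsSymm) (htr : u₀.trace = 0) (hC : 0 < C)
    (hpos : ((C / 2) • (1 : Matrix (Fin 2) (Fin 2) ℝ) - (Matrix.vecMulVec v₀ v₀ - u₀)).PosDef) :
    ∃ v₁ v₂ : ℝ × EuclideanSpace ℝ (Fin 2) → EuclideanSpace ℝ (Fin 2),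
      Measurable v₁ ∧ Measurable v₂ ∧
      (∀ᵐ z ∂(volume.restrict Ω), ‖v₁ z‖ ^ 2 = C) ∧ (∀ᵐ z ∂(volume.restrict Ω), ‖v₂ z‖ ^ 2 = C) ∧
      ¬ (v₁ =ᵐ[volume.restrict Ω] v₂) := by
  obtain ⟨v, hne, hv⟩ := h Ω hΩ hΩne v₀ u₀ C hsymm htr hC hpos
  exact ⟨v 0, v 1, (hv 0).1, (hv 1).1, (hv 0).2.1, (hv 1).2.1, hne 0 1 (by decide)⟩

/-- The strict subsolution condition for the *rest state with a trace-free diagonal stress*: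
for `v₀ = 0` and `u₀ = diag(g, -g)` it reads `|g| < C/2`. This is the case used for symmetric
two-shock Riemann data. [cite: Markfelder2021, (8.32)–(8.33)] -/
theorem posDef_rest_diag {C g : ℝ} (hg : |g| < C / 2) :
    ((C / 2) • (1 : Matrix (Fin 2) (Fin 2) ℝ) -
      (Matrix.vecMulVec (0 : EuclideanSpace ℝ (Fin 2)) (0 : EuclideanSpace ℝ (Fin 2)) -
        Matrix.diagonal ![g, -g])).PosDef := by
  have h : ((C / 2) • (1 : Matrix (Fin 2) (Fin 2) ℝ) -
      (Matrix.vecMulVec (0 : EuclideanSpace ℝ (Fin 2)) (0 : EuclideanSpace ℝ (Fin 2)) -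
        Matrix.diagonal ![g, -g])) = Matrix.diagonal ![C / 2 + g, C / 2 - g] := by
    ext i j
    fin_cases i <;> fin_cases j <;> simp [Matrix.vecMulVec, Matrix.diagonal]
  rw [h, Matrix.posDef_diagonal_iff]
  intro i
  fin_cases i
  · simp
    linarith [neg_abs_le g]
  · simp
    linarith [le_abs_self g]

end Literature.Analysis.FluidPDE.ConvexIntegration

end
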